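import Summits.QuantumFields.BalabanUV.Beta.CombChartJointEndReflTablesAn1S2RD
import Summits.QuantumFields.BalabanUV.Beta.RowD1JointEndSymReflTablesAn1S2Z

/-!
# `BalabanUV.Beta.CombChartJointEndReflTablesAn1S2Z` — binder row D1, RULING R-D1-g35-1 (chart (III′)), programme P6: **THE (III′) TWIN OF chart (II)'s ROOT `RowD1JointEndSymReflTablesAn1S2Z`** — the same
# root-level REDUCTION STEP performed on the chart-(III′) repair track (literal `JsB12CombShSym`, resolvents `GcombSh Lc j`, an1's shift `Dsh Lc`), consuming the
# SAME table-level suppliers BY NAME and the (III′) engine twins (`…Comb` files of this gen) where chart (II) consumed the `…Sym` engines; chart (II)'s displayed scalar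
# identity `hcomp` is REPLACED throughout by the repair track's `hRm0 : tadpole (GcombSh Lc j) (Rm_j …) = 0` (P5) at the same W-remainder `Rm_j`.
# WHAT CHANGES relative to `RowD1JointEndSymReflTablesAn1S2Z`: nothing but these substitutions (text transformed by name; see that file's docstring for the letter-by-letter account).

HONEST FRAMING (cell contract, verbatim): «discharging `BetaPertH` makes Bałaban's UV stability UNCONDITIONAL — a real constructive-QFT
result; it is NOT the continuum limit and NOT the Clay problem.»  HONEST DEPENDENCY: continuum YM on T⁴ ⇐ BetaPertH ∧ nine spine estimates (0/9 proved);
BetaPertH ⇐ (D1) ∧ (D4) ∧ CAP+tail; G-an2-4 gates asym, D1 and NE2/3/4.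
DERIVED cell leaf ([folklore] wiring BY NAME; β sub-cell, BINDER-OWNERS row D1 OWNER `b2b-balaban-beta-an2` gen 36).  No statement of Bałaban's papers, no `[cite:]`,
no `Prop` fact, no `def`; every displayed letter is a BINDER.  THIS IS THE REPAIR TRACK (RULING R-D1-g35-1 (5)): the RECORD stays ROOT M′ p303989 over `JsB12Sym`.
HONEST: composition by name; repair-track root classes {hW∕hR table letters, `hRm0`, D1Tel, D1Rep} 0∕4 discharged; row D1 binders 0∕4; NOT D1, NOT `BetaPertH`,
NOT continuum, NOT Clay.  Provenance: β sub-cell, unit beta-an2 gen 36, 2026-08-22 (v1) ∕ gen 37 (v1.1: the resolvent-free lemma `loc_diagK_zeroTable` is IMPORTED from the chart-(II) twin `RowD1JointEndSymReflTablesAn1S2Z` instead of restated — gate `dedup.landed` on p322159); no existing file touched.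
-/

noncomputable section

open Finset
open scoped BigOperators
open Literature.Probability.LatticeModels (Torus.proj)
open Literature.MathematicalPhysics.QuantumFieldTheory
open Literature.MathematicalPhysics.QuantumFieldTheory.Balaban1983to89
open Literature.MathematicalPhysics.QuantumFieldTheory.Balaban1983to89.Beta
open Literature.MathematicalPhysics.QuantumFieldTheory.Balaban1983to89.Beta.VectorTailsLoc (fam kfam)
open Literature.MathematicalPhysics.QuantumFieldTheory.Balaban1983to89.Beta.VectorLegVolumeAdapter (MvE)
open ExpKernelCalculus (MKer BiLoc VertexFamily comp tr tadpole shiftK)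
open PolarizationSign (reflSign WardTransversal AxisReflectionCovariant)
open KernelReflection (refK)
open ResolventReflection (bref Φ)
open AffineAveraging (box toSite)
open AveragingContoursRooted (ctr ctrOff ctrOff_mem_box)
open OneStepResolventKernel (Fib LocStencil JetData)
open OneStepKernelFamily (KInvStep colH vertexOfK TbalOf flipK D1Tel D1Rep D1Drift)
open KernelWard (divV divW)
open StepJetData (mfNeg wilsonA)
open BalabanStepJetsSucc (mmRead wE wVH)
open SecondOrderResponse (dM W2OfK LocStencilFM)
open BalabanCompositeJets (LocStencil₂)
open BalabanStepW2 (M2Of wB2 wV4)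
open WilsonBiStencil (wilsonW₂)
open WilsonVertex2Sym (wsym22)
open Summit.QuantumFields.BalabanUV.Beta.TameKernelCalculus
open Summit.QuantumFields.BalabanUV.Beta.ChartConjugation (conjV conjW)
open Summit.QuantumFields.BalabanUV.Beta.ChartConjugationDefectEnd (conjDefect sandwichDefect)
open Summit.QuantumFields.BalabanUV.Beta.AxialDressingRooted (one_le_of_neZero)
open Summit.QuantumFields.BalabanUV.Beta.SymmetrisedDressingKernel (coDressKSymAt)
open Summit.QuantumFields.BalabanUV.Beta.AveragingWardRootedStencils (legInd)
open Summit.QuantumFields.BalabanUV.Beta.SymmetrisedStepJets (SymTables)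
open Summit.QuantumFields.BalabanUV.Beta.CombChartStepJets (GcombSh ScombOf SpureCombOf JsB12CombSh0)
open Summit.QuantumFields.BalabanUV.Beta.CombChartJointEnd (JsB12CombShSym)
open Summit.QuantumFields.BalabanUV.Beta.SpineRooted (M1Of SpureRecOf T2RecOf WrecOf)
open Summit.QuantumFields.BalabanUV.Beta.WardLocusRecursive (SrecOf)
open Summit.QuantumFields.BalabanUV.Beta.WardLocusCubic (mmSym)
open Summit.QuantumFields.BalabanUV.Beta.SymShiftedSpread (bhKStepSh)
open Summit.QuantumFields.BalabanUV.Beta.BorderedHessian (sgnK bhK stepScale diagK)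
open Summit.QuantumFields.BalabanUV.Beta.E3ContactGenerator (ctGenM)
open Summit.QuantumFields.BalabanUV.Beta.DshAn1 (Dsh)
open Summit.QuantumFields.BalabanUV.Beta.SymAveragingHessianCounts (symVhSAt symHessFFAt)
open Summit.QuantumFields.BalabanUV.Beta.SymAveragingMixedJetTables (symMixFFAt)
open Summit.QuantumFields.BalabanUV.Beta.SymSecondOrderTablesAn1 (symVh₂SAn1 symTablesAn1S2 locStencil₂_symVh₂SAn1 symVh₂SAn1_hBt symVh₂SAn1_inl_inl
  symMixFFAt_hmix_ctr symMixFFAt_hmixt)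
open Summit.QuantumFields.BalabanUV.Beta.CombChartJointEndReflTablesAn1S2 (d1Drift_JsB12CombShSym_an1TablesS2_of_bordMixLetters_reflTableLettersRem_D1Tel_D1Rep)
open Summit.QuantumFields.BalabanUV.Beta.SymMixedReflectionLetterAn1 (symRMrAn1 hM2_symMixFFAt)

open Summit.QuantumFields.BalabanUV.Beta.CombChartJointEndReflTablesAn1S2RD (d1Drift_JsB12CombShSym_an1TablesS2_of_locks_contact_splitLoc_hcomp_D1Tel_D1Rep)
open Summit.QuantumFields.BalabanUV.Beta.CombSecondOrderRemainderAn1 (combΔAn1)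
open Summit.QuantumFields.BalabanUV.Beta.BorderedHessian (diagK_apply)
open Summit.QuantumFields.BalabanUV.Beta.RowD1JointEndSymReflTablesAn1S2Z (loc_diagK_zeroTable)

namespace Summit.QuantumFields.BalabanUV.Beta.CombChartJointEndReflTablesAn1S2Z

variable {Lc : ℕ} [NeZero Lc]

/-- **ROW D1 — THE LITERAL ROOT, CONTACT DATA PINNED: `D1Drift ⟸ hΛ ∧ hcB ∧ hΔL ∧ hRm0 ∧ D1Tel ∧ D1Rep`** (+ the route theorem's own binders) — ROOT L with
`γ := fun j ↦ −(Lc⁸∕2)·wVH j ∕ (stepScale j·Lc⁴)` (`hγ := rfl`), `X2s := 0` (`hX2L := loc_diagK_zeroTable`); four binders fewer.  HONEST: composition by name;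
one admissible pin of `X2s` (X-an2-60 stays the planner's ∕ an3's to rule); `hRm0` displayed, NOT claimed; NOT D1. -/
theorem d1Drift_JsB12CombShSym_an1TablesS2_pinned_of_locks_splitLoc_hcomp_D1Tel_D1Rep (hLc : Odd Lc) (hL2 : 2 ≤ Lc) {N : ℕ} (hN : 2 ≤ N) (cΛ cB : ℝ)
    -- the two unit locks of an1's TABLE-FIT tier 2 (Λ-lock of `SymMixedWardSiteLaw.symBondWardM`, B-lock of `SymBorderWardSiteLaw.symBondWardB`)
    (hΛ : cΛ * (Lc : ℝ) ^ 4 = 2) (hcB : cB = -((Lc : ℝ) ^ 12 / 4))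
    -- hR, SECOND ORDER: the localisation of the defined split defect at the pinned contact data
    (hΔL : ∀ j α μ y ν y', Loc (combΔAn1 Lc N cΛ (fun j => -((Lc : ℝ) ^ 8 / 2) * wVH 3 Lc j / (stepScale 3 Lc j * (Lc : ℝ) ^ 4)) (0 : ℕ → Fin 4 → Fin 4 → (Fin 4 → ℤ) → Fin 4 → (Fin 4 → ℤ) → (Fin 4 → ℤ) → Fib 3 → ℝ) j α μ y ν y'))
    -- the cancellation of the chart-(II) defect against the W-REMAINDER `Rm_j` (`Wc := Rm`, `X₂ := 0`) — the (N8) object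
    (hRm0 : ∀ (j : ℕ) (α μ : Fin 4) (y : Fin 4 → ℤ) (ν : Fin 4) (y' : Fin 4 → ℤ),
      tadpole (GcombSh Lc j)
        ((1 / 2 : ℝ) • conjV (bhKStepSh 3 Lc (Dsh Lc) j) (diagK fun p a => (0 : ℕ → Fin 4 → Fin 4 → (Fin 4 → ℤ) → Fin 4 → (Fin 4 → ℤ) → (Fin 4 → ℤ) → Fib 3 → ℝ) j α ν y' μ y p a - (0 : ℕ → Fin 4 → Fin 4 → (Fin 4 → ℤ) → Fin 4 → (Fin 4 → ℤ) → (Fin 4 → ℤ) → Fib 3 → ℝ) j α μ y ν y' p a) +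
          (1 / 2 : ℝ) • (combΔAn1 Lc N cΛ (fun j => -((Lc : ℝ) ^ 8 / 2) * wVH 3 Lc j / (stepScale 3 Lc j * (Lc : ℝ) ^ 4)) (0 : ℕ → Fin 4 → Fin 4 → (Fin 4 → ℤ) → Fin 4 → (Fin 4 → ℤ) → (Fin 4 → ℤ) → Fib 3 → ℝ) j α μ y ν y' + combΔAn1 Lc N cΛ (fun j => -((Lc : ℝ) ^ 8 / 2) * wVH 3 Lc j / (stepScale 3 Lc j * (Lc : ℝ) ^ 4)) (0 : ℕ → Fin 4 → Fin 4 → (Fin 4 → ℤ) → Fin 4 → (Fin 4 → ℤ) → (Fin 4 → ℤ) → Fib 3 → ℝ) j α ν y' μ y)) = 0)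
    -- the route theorem's own binders, verbatim
    (a : ℝ) (ha : 0 < a)
    (h12 : B5.Prop12Printed (fam (fun i : ℕ+ × ℕ => ((i.1 : ℕ+) : ℕ)) (fun i => i.1.pos) MvE a ha))
    (h126 : B5.Kernel126_127Printed (kfam (fun i : ℕ+ × ℕ => ((i.1 : ℕ+) : ℕ)) MvE))
    {L : Type*} {SL : Finset L} (hSL : SL.Nonempty) (k : L → Fin 4) {μ ν : Fin 4} (hμν : μ ≠ ν) {Nc : ℝ} (hNc : Nc ≠ 0)
    (Jc : ∀ m : ℕ, JetData 3 (Lc ^ m))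
    (htel : D1Tel Lc (JsB12CombShSym hLc N (symTablesAn1S2 3 Lc cΛ) cΛ cB) Jc)
    {cc : ℝ} {Mw' : ℕ → ℕ} (hc : 1 ≤ cc) (hMwin : ∀ L : ℕ, 2 ≤ L → 1 ≤ Mw' L ∧ (L : ℝ) ≤ cc * Mw' L) (hML : ∀ L : ℕ, 2 ≤ L → Mw' L ≤ L)
    (hrep : D1Rep Lc Jc Nc μ ν a SL k) :
    D1Drift Lc (JsB12CombShSym hLc N (symTablesAn1S2 3 Lc cΛ) cΛ cB) Nc μ ν := by
  exact d1Drift_JsB12CombShSym_an1TablesS2_of_locks_contact_splitLoc_hcomp_D1Tel_D1Rep hLc hL2 hN cΛ cB hΛ hcB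
    (fun j => -((Lc : ℝ) ^ 8 / 2) * wVH 3 Lc j / (stepScale 3 Lc j * (Lc : ℝ) ^ 4)) (fun _ => rfl) 0 loc_diagK_zeroTable hΔL hRm0 a ha h12 h126 hSL k hμν
    hNc Jc htel hc hMwin hML hrep

end Summit.QuantumFields.BalabanUV.Beta.CombChartJointEndReflTablesAn1S2Z

end
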